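import Literature.AlgebraicGeometry.Motives.KugaSatakeHodgeConjecture
import Literature.AlgebraicGeometry.Motives.HodgeStructureDirectSum
import Literature.AlgebraicGeometry.HodgeTheory.AbelianVarietyHodgeEssentialImageRecord
import Literature.AlgebraicGeometry.HodgeTheory.CanonicalTrace
import Literature.AlgebraicGeometry.HodgeTheory.MotivatedClasses
import HarnessLib

/-!
# The Kuga–Satake class of a surface with `h^{2,0} = 1` and the property "the Kuga–Satake correspondence is algebraic", on the REAL carriers `Hᵏ(–(ℂ); ℚ)`

Layer `Literature/AlgebraicGeometry/HodgeTheory`; DEFINITIONS ONLY (no named fact, nothing asserted).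
Definition request D2 of the Hodge-ladder stage-4 scoping (run/shared/lean/pub/hodge-director/
STAGE4-ABELIAN-MOTIVIC-TYPE.md §10: "a real-carrier Kuga–Satake class `κ_S`, so that `KSH_K3` has a
`HodgeConjectureFor`-compatible twin").  The tree already renders van Geemen's Kuga–Satake–Hodge
conjecture (vG 10.2) and the Huybrechts/Floccari "Kuga–Satake correspondence is algebraic" property in
FRAMEWORK `B` (`Motives/KugaSatakeHodgeConjecture`, `Motives/KugaSatakeCorrespondenceAlgebraic`:
relative to an abstract Betti–Hodge datum `B : BettiHodgeData ℂ`).  This file writes the SAME clauses,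
symbol for symbol, on the carriers of the summit statement: rational singular cohomology
`Motives.bettiCohomology X k = Hᵏ(X(ℂ); ℚ)` with the `ℚ`-Hodge structure `HodgeModel.hodgeStructure` of a
Hodge-symmetric Hodge model (file `HodgeStructureOfHodgeModel`; for an abelian variety
`bettiOneHodgeStructure`, file `AbelianVarietyHodgeEssentialImageRecord`), the tree's cup product
`cupProduct`, its canonical trace `trace hS : H⁴(S(ℂ); ℚ) → ℚ` (file `CanonicalTrace`), pull-backs
`Motives.bettiCohomology.map`, the rational lattice `ofRatClass : Hᵏ(–; ℚ) → Hᵏ(–; ℂ)`, and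
"induced by an algebraic cycle" = the tree's `IsAlgebraicCorrespondence` (file `MotivatedClasses`:
`γ^* = pr_{W*}(pr_X^* (·) ∪ γ)` for an algebraic class `γ`).

Sources read verbatim (materialised texts `paper:arxiv-2501.02315`, `paper:arxiv-math_9903146`, held
book `Huybrechts2016K3`):
* S. Floccari, *K3 surfaces associated with varieties of generalized Kummer type*, Geom. Topol. 30
  (2026) [Floccari2026], §3.1: "We fix a vector `v₀ ∈ V` such that `q(v₀, v₀) ≠ 0`. Setting
  `μ(v)(a) := v · a · v₀` we obtain an embedding `μ : V ↪ End(C⁺(V))`"; §3.2: "the Hodge structure on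
  `V` determines an effective polarizable Hodge structure of weight `1` on `C⁺(V)`. This thus defines
  an abelian variety `KS(V)` up to isogeny, such that `H¹(KS(V), ℚ) ≅ C⁺(V)`"; §3.3: "identifying
  `H¹(KS(S), ℚ)^∨` with `H¹(KS(S), ℚ)(1)` by means of a polarization, we get the embedding of Hodge
  structures `μ' : H²(S, ℚ)_prim ↪ H¹(KS(S), ℚ)^{⊗2} ⊂ H²(KS(S)², ℚ)`.  **Conjecture 3.3.** The morphism
  `μ'` is induced by an algebraic cycle on `S × KS(S)²`."; **Remark 3.4**: "As a variant, we may define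
  `KS'(S)` as the Kuga-Satake variety built from the smaller Hodge structure of K3-type `H²_tr(S, ℚ)`;
  then the Kuga-Satake variety `KS(S)` built from `H²(S, ℚ)_prim` is isogenous to a power of `KS'(S)`
  (see [Huybrechts]). Moreover, Conjecture 3.3 is equivalent to the statement that the embedding
  `μ' : H²_tr(S, ℚ) ↪ H¹(KS'(S), ℚ)^{⊗2} ⊂ H²(KS'(S)², ℚ)` analogous to (3.2) is induced by an algebraic
  cycle."
* B. van Geemen, *Kuga-Satake varieties and the Hodge conjecture* [vanGeemen2000KugaSatakeHC], 5.2,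
  5.9 (`E(v, w) := Tr(α ι(v) w)`, `α = ± e₁e₂`), 6.3 (`M_v = [y ↦ v y e₁]`, `V ↪ C⁺(Q) ⊗ C⁺(Q)`), 8.1
  ("There is a natural isomorphism of rational … weight one Hodge structures `H¹(A_Γ, ℚ) ≅ (C⁺(Q), h_s)`"),
  8.3, 10.1 ("`H²(X, ℚ) = V ⊕ NS(X)_ℚ`", "`Q` the induced polarization on `V`").
* D. Huybrechts, *Lectures on K3 Surfaces* [Huybrechts2016K3], Ch. 4 §2.6 ("an element
  `κ_X ∈ H⁴(X × KS(X) × KS(X), ℚ)` of type `(2,2)`, the Kuga–Satake class"), Conj. 2.11, §2.5 (the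
  intersection form "really is a polarization of `ℓ^⊥` (up to sign)"); Ch. 3 Def. 2.5 / Lemma 3.1
  (`T(X)_ℚ = NS(X)_ℚ^⊥` for projective `X`).

## What is quantified (the clauses of the framework-`B` files, on real carriers)

For a smooth projective complex surface `S` (`hS : IsSmoothProjective 2 S`) and a Hodge-symmetric Hodge
model `M` of `S` (all models give the same `H^{p,q}`, `hodgePQ_independent_of_hodgeModel_holds`; real,
hence symmetric, models exist, `exists_isReal_hodgeModel_holds`):
1. `cupPairingBetti hS` — the rational intersection form `(a, b) ↦ ∫_S a ∪ b` on `H²(S(ℂ); ℚ)`;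
   `transcendentalLatticeBetti hS M hM = NS(S)_ℚ^⊥`, the orthogonal of the Hodge classes
   `Hdg¹ = (M.hodgeStructure hS hM 2).hodgeClasses 1` (`= NS(S)_ℚ` by Lefschetz `(1,1)`).
2. `IsTranscendentalPartBetti` — a presentation `(T, H, P, j, ε)` of vG's `(V, h, Q)`: an injective
   morphism of Hodge structures `j : T → H²(S(ℂ); ℚ)` onto `NS(S)_ℚ^⊥` with
   `P(t, t') = ε ∫_S j t ∪ j t'`, `ε = ±1`.  The SIGN is a binder because the tree's canonical trace is
   Voisin's `∫_S` only up to the universal convention sign of `ComplexOrientationFamily` (module docstring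
   of `CanonicalTrace`: positivity is not claimed there); classically exactly one sign makes `-∫ j t ∪ j t'`
   resp. `∫ j t ∪ j t'` a polarization of the K3-type structure `T(S)_ℚ` (vG 1.8 / Huybrechts §2.5: minus
   the intersection form), and for that sign presentations EXIST (take `T = T(S)_ℚ`), so no universally
   quantified statement below is vacuous classically, whatever the convention sign is.
3. van Geemen's choices `e₁, e₂, κ_C` exactly as in `BettiHodgeData.KugaSatakeHodgeConjectureFor`
   (`KugaSatake.IsTensorEmbedding`, `KugaSatake.traceForm`).
4. `IsKugaSatakeVarietyBetti` — "`A` is a Kuga–Satake variety of `(T, H, P)`" (vG 8.1 / Floccari §3.2):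
   a complex abelian variety `A : Motives.AbelianVariety ℂ` with a Hodge-symmetric Hodge model `B` and a
   `ℚ`-linear isomorphism `θ : H¹(A(ℂ); ℚ) ≃ C⁺(Q)` carrying the Hodge filtration of
   `bettiOneHodgeStructure A B hB` onto that of the tree's `HodgeStructure.kugaSatake H P hT`.
5. `kugaSatakeClassMapBetti θ κ_C : T → H²((A × A)(ℂ); ℚ)` — `v ↦ (pr₁^* ⊗ pr₂^*)(θ⁻¹ ⊗ θ⁻¹)(κ_C v)`
   followed by the cup product (vG 8.3, Huybrechts §2.6 "by the Künneth formula"; Floccari's `μ'`).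
6. `IsKSCorrespondenceAlgebraicBetti hS` — **"the Kuga–Satake correspondence of `S` is algebraic"**
   (Floccari Conj. 3.3 in the `H²_tr`-form of Remark 3.4; Huybrechts Conj. 4.2.11 "for the transcendental
   lattices"): for all data 1–5, the complexification of `μ'` is the restriction to `T(S)` of a map
   `O : H²(S(ℂ); ℂ) → H²((A × A)(ℂ); ℂ)` INDUCED BY AN ALGEBRAIC CYCLE on `(A × A) × S`
   (`IsAlgebraicCorrespondence`).  A predicate, asserted for no `S`.

Deliberately NOT here: any equivalence with the framework-`B` renderings; the Gysin form of vG 10.2;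
existence of Kuga–Satake varieties on these carriers (it follows from Riemann's theorem, the tree's record
`DeligneMilne1982_Thm_6_20_essImage`, once polarisability — named fact
`kugaSatake_exists_polarization_traceForm` — effectivity and finiteness of the Kuga–Satake structure
are supplied; not needed to STATE anything); any assertion.
-/

noncomputable section

open CategoryTheory MonoidalCategory CartesianMonoidalCategory
open scoped TensorProduct
open Literature.AlgebraicTopology.SingularHomology

namespace Literature.AlgebraicGeometry.HodgeTheory

open Literature.AlgebraicGeometry.Motives (SchemeOver IsSmoothProjective AbelianVariety bettiCohomology
  HodgeStructure)

/-! ### The rational intersection form and the transcendental lattice of a surface -/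

section Surface

variable {S : SchemeOver ℂ} (hS : IsSmoothProjective 2 S)

/-- **The rational intersection form** `(a, b) ↦ ∫_S a ∪ b` on `H²(S(ℂ); ℚ)` of a smooth projective
complex surface: the tree's cup product `H² × H² → H⁴` followed by the canonical trace `trace hS`
(Voisin I §7.1.2 "the intersection form `Q` is integral"; vG 10.1). [cite: VoisinHodgeI2002, §7.1.2 and §11.1.2]
[cite: vanGeemen2000KugaSatakeHC, §10.1] -/
def cupPairingBetti : LinearMap.BilinForm ℚ (bettiCohomology S (2 * 1)) :=
  (cupProduct (X := Motives.ComplexPoints S) (R := ℚ) (show 2 * 1 + 2 * 1 = 2 * 2 from rfl)).compr₂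
    (trace hS)

/-- Unfolding: `cupPairingBetti hS a b = ∫_S (a ∪ b)`. [cite: VoisinHodgeI2002, §7.1.2] -/
theorem cupPairingBetti_apply (a b : bettiCohomology S (2 * 1)) :
    cupPairingBetti hS a b =
      trace hS (cupProduct (X := Motives.ComplexPoints S) (R := ℚ)
        (show 2 * 1 + 2 * 1 = 2 * 2 from rfl) a b) :=
  rfl

/-- **The rational transcendental lattice** `T(S)_ℚ := NS(S)_ℚ^⊥ ⊂ H²(S(ℂ); ℚ)`: the orthogonal, for
the intersection form, of the Hodge classes `Hdg¹ ⊂ H²(S(ℂ); ℚ)` of the `ℚ`-Hodge structure of the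
Hodge model `M` (`= NS(S)_ℚ` by Lefschetz `(1,1)`; vG 10.1 "`H²(X, ℚ) = V ⊕ NS(X)_ℚ`"; Huybrechts Ch. 3
Def. 2.5, Lemma 3.1).  The real-carrier twin of `BettiHodgeData.transcendentalLattice`.
[cite: vanGeemen2000KugaSatakeHC, §10.1] [cite: Huybrechts2016K3, Ch. 3 Def. 2.5 and Lemma 3.1] -/
def transcendentalLatticeBetti (M : HodgeModel 2 S) (hM : M.IsHodgeSymmetric) :
    Submodule ℚ (bettiCohomology S (2 * 1)) :=
  (cupPairingBetti hS).orthogonal ((M.hodgeStructure hS hM (2 * 1)).hodgeClasses 1)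

/-- Membership in `T(S)_ℚ`: `∫_S n ∪ x = 0` for every Hodge class `n ∈ Hdg¹`. [cite: Huybrechts2016K3, Ch. 3 Lemma 3.1] -/
theorem mem_transcendentalLatticeBetti_iff (M : HodgeModel 2 S) (hM : M.IsHodgeSymmetric)
    (x : bettiCohomology S (2 * 1)) :
    x ∈ transcendentalLatticeBetti hS M hM ↔
      ∀ n ∈ (M.hodgeStructure hS hM (2 * 1)).hodgeClasses 1, cupPairingBetti hS n x = 0 :=
  Iff.rfl

/-- The weight-two `ℚ`-Hodge structure `H²_B(S)` of the model `M`, with its weight `((2 * 1 : ℕ) : ℤ)`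
transported to the literal `2` (`HodgeStructure.cast`; same filtration). [cite: VoisinHodgeI2002, §7.1.1] -/
abbrev bettiTwoHodgeStructure (M : HodgeModel 2 S) (hM : M.IsHodgeSymmetric) :
    HodgeStructure (bettiCohomology S (2 * 1)) 2 :=
  (M.hodgeStructure hS hM (2 * 1)).cast (by norm_num)

/-- `(T, H, P)` with `j : T → H²(S(ℂ); ℚ)` and the sign `ε` **presents the transcendental part**
`(V, h, Q)` of the surface `S` on the real carriers (vG 10.1–10.2): `j` is an injective morphism of
`ℚ`-Hodge structures into `H²_B(S)` (the structure of the Hodge model `M`) whose image is `T(S)_ℚ =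
NS(S)_ℚ^⊥` (`transcendentalLatticeBetti`), and `P(t, t') = ε ∫_S j t ∪ j t'` with `ε = ±1` — "the induced
polarization on `V`", i.e. the intersection form up to the sign making it a polarization (vG 1.8;
Huybrechts Ch. 4 §2.5 "up to sign"); the sign is a binder because the tree's `trace` is normalised only
up to a universal sign (module docstring).  Real-carrier twin of `BettiHodgeData.IsTranscendentalPart`.
[cite: vanGeemen2000KugaSatakeHC, §10.1–10.2] [cite: Huybrechts2016K3, Ch. 4 §2.5] -/
def IsTranscendentalPartBetti (M : HodgeModel 2 S) (hM : M.IsHodgeSymmetric)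
    {T : Type} [AddCommGroup T] [Module ℚ T] (H : HodgeStructure T 2) (P : H.Polarization) (ε : ℤˣ)
    (j : H.Hom (bettiTwoHodgeStructure hS M hM)) : Prop :=
  Function.Injective j.toLinearMap ∧
    LinearMap.range j.toLinearMap = transcendentalLatticeBetti hS M hM ∧
    P.form = ((ε : ℤ) : ℚ) • (cupPairingBetti hS).compl₁₂ j.toLinearMap j.toLinearMap

/-- Unfolding lemma. [cite: vanGeemen2000KugaSatakeHC, §10.1–10.2] -/
theorem isTranscendentalPartBetti_iff (M : HodgeModel 2 S) (hM : M.IsHodgeSymmetric)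
    {T : Type} [AddCommGroup T] [Module ℚ T] (H : HodgeStructure T 2) (P : H.Polarization) (ε : ℤˣ)
    (j : H.Hom (bettiTwoHodgeStructure hS M hM)) :
    IsTranscendentalPartBetti hS M hM H P ε j ↔
      Function.Injective j.toLinearMap ∧
        LinearMap.range j.toLinearMap = transcendentalLatticeBetti hS M hM ∧
        ∀ t t' : T, P.form t t' = ((ε : ℤ) : ℚ) * cupPairingBetti hS (j.toLinearMap t) (j.toLinearMap t') := by
  refine and_congr_right fun _ ↦ and_congr_right fun _ ↦ ?_
  constructor
  · intro h t t'
    rw [h]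
    rfl
  · intro h
    ext t t'
    exact h t t'

end Surface

/-! ### Kuga–Satake varieties and the Kuga–Satake class, on real carriers -/

section KugaSatakeVariety

variable {T : Type} [AddCommGroup T] [Module ℚ T] (H : HodgeStructure T 2) (P : H.Polarization)
variable (hT : H.hodgeNumber 2 0 = 1)

/-- **`A` is a Kuga–Satake variety of `(V, h, Q)`, witnessed by `θ`**, on the real carriers (vG 8.1:
"Each variety in this isogeny class is called a Kuga-Satake variety … There is a natural isomorphism of
rational … weight one Hodge structures `H¹(A_Γ, ℚ) ≅ (C⁺(Q), h_s)`"; Floccari §3.2 "an abelian variety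
`KS(V)` up to isogeny, such that `H¹(KS(V), ℚ) ≅ C⁺(V)`"): `A` is a complex abelian variety, `B` a
Hodge-symmetric Hodge model of `A`, and the `ℚ`-linear isomorphism `θ : H¹(A(ℂ); ℚ) ≃ C⁺(Q)` carries the
Hodge filtration of `H¹_B(A)` (`bettiOneHodgeStructure A B hB`) onto the Kuga–Satake filtration of the
tree's `HodgeStructure.kugaSatake H P hT` (an isomorphism of rational Hodge structures).  Real-carrier
twin of `BettiHodgeData.IsKugaSatakeVariety`. [cite: vanGeemen2000KugaSatakeHC, §8.1] [cite: Floccari2026, §3.2] -/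
def IsKugaSatakeVarietyBetti (A : AbelianVariety ℂ) (B : HodgeModel A.dim A.X) (hB : B.IsHodgeSymmetric)
    (θ : bettiCohomology A.X 1 ≃ₗ[ℚ] CliffordAlgebra.even P.quadraticForm) : Prop :=
  ∀ p : ℤ, ((bettiOneHodgeStructure A B hB).F p).map (θ.toLinearMap.baseChange ℂ) =
    (H.kugaSatake P hT).F p

/-- **The external cup product `H¹(A(ℂ); ℚ) ⊗ H¹(A(ℂ); ℚ) → H²((A × A)(ℂ); ℚ)`**,
`a ⊗ b ↦ pr₁^* a ∪ pr₂^* b` (Künneth; vG 8.3 "`H¹(A_Γ, ℚ) ⊗ H¹(A_Γ, ℚ) ⊂ H²(A_Γ × A_Γ, ℚ)`"; Huybrechts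
Ch. 4 §2.6), from the tree's pull-backs `Motives.bettiCohomology.map` along the two projections of the
monoidal product `A ⊗ A = A ×_ℂ A` and the cup product. [cite: vanGeemen2000KugaSatakeHC, §8.3]
[cite: Huybrechts2016K3, Ch. 4 §2.6] -/
def externalCupOneOne (A : SchemeOver ℂ) :
    bettiCohomology A 1 →ₗ[ℚ] bettiCohomology A 1 →ₗ[ℚ] bettiCohomology (A ⊗ A) 2 :=
  (cupProduct (X := Motives.ComplexPoints (A ⊗ A)) (R := ℚ) (show 1 + 1 = 2 from rfl)).compl₁₂
    (bettiCohomology.map (fst A A) 1).hom (bettiCohomology.map (snd A A) 1).hom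

/-- Unfolding: `externalCupOneOne A a b = pr₁^* a ∪ pr₂^* b`. [cite: vanGeemen2000KugaSatakeHC, §8.3] -/
theorem externalCupOneOne_apply (A : SchemeOver ℂ) (a b : bettiCohomology A 1) :
    externalCupOneOne A a b =
      cupProduct (X := Motives.ComplexPoints (A ⊗ A)) (R := ℚ) (show 1 + 1 = 2 from rfl)
        (bettiCohomology.map (fst A A) 1 a) (bettiCohomology.map (snd A A) 1 b) :=
  rfl

/-- **The Kuga–Satake class map** `V → H²((A × A)(ℂ); ℚ)` on the real carriers: `v ↦` the image of
`κ_C(v) ∈ C⁺(Q) ⊗ C⁺(Q)` under `θ⁻¹ ⊗ θ⁻¹ : C⁺(Q) ⊗ C⁺(Q) ≃ H¹(A(ℂ); ℚ) ⊗ H¹(A(ℂ); ℚ)` and the external cup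
product (vG 8.3 / 10.1 "`V ↪ H¹(A_Γ, ℚ) ⊗ H¹(A_Γ, ℚ) ⊂ H²(A_Γ × A_Γ, ℚ)`"; Floccari's `μ'`; Huybrechts' class
`κ_X`).  Real-carrier twin of `BettiHodgeData.kugaSatakeClassMap`. [cite: vanGeemen2000KugaSatakeHC, §8.3]
[cite: Floccari2026, §3.3 (3.2)] -/
def kugaSatakeClassMapBetti {A : SchemeOver ℂ}
    (θ : bettiCohomology A 1 ≃ₗ[ℚ] CliffordAlgebra.even P.quadraticForm)
    (κ : T →ₗ[ℚ] CliffordAlgebra.even P.quadraticForm ⊗[ℚ] CliffordAlgebra.even P.quadraticForm) :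
    T →ₗ[ℚ] bettiCohomology (A ⊗ A) 2 :=
  TensorProduct.lift (externalCupOneOne A) ∘ₗ
    TensorProduct.map θ.symm.toLinearMap θ.symm.toLinearMap ∘ₗ κ

/-- On a vector whose tensor image is a pure tensor `x ⊗ y`, the Kuga–Satake class is
`pr₁^* θ⁻¹(x) ∪ pr₂^* θ⁻¹(y)`. [cite: vanGeemen2000KugaSatakeHC, §8.3] -/
theorem kugaSatakeClassMapBetti_apply_of_eq_tmul {A : SchemeOver ℂ}
    (θ : bettiCohomology A 1 ≃ₗ[ℚ] CliffordAlgebra.even P.quadraticForm)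
    (κ : T →ₗ[ℚ] CliffordAlgebra.even P.quadraticForm ⊗[ℚ] CliffordAlgebra.even P.quadraticForm)
    {v : T} {x y : CliffordAlgebra.even P.quadraticForm} (hv : κ v = x ⊗ₜ[ℚ] y) :
    kugaSatakeClassMapBetti H P θ κ v = externalCupOneOne A (θ.symm x) (θ.symm y) := by
  simp [kugaSatakeClassMapBetti, hv]

end KugaSatakeVariety

/-! ### "The Kuga–Satake correspondence of `S` is algebraic" (Floccari 2026 §3.3–3.4; Huybrechts Ch. 4 §2.6), on real carriers -/

section Correspondence

/-- **The Kuga–Satake correspondence of the surface `S` is algebraic** — the PROPERTY of the smooth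
projective surface `S` (asserted for no `S` in this file; for which `S` it holds is the business of the
theorems citing it), in the transcendental-lattice form of Floccari 2026 Remark 3.4 ("equivalent to the
statement that the embedding `μ' : H²_tr(S, ℚ) ↪ H¹(KS'(S), ℚ)^{⊗2} ⊂ H²(KS'(S)², ℚ)` … is induced by an
algebraic cycle") = Huybrechts Ch. 4, 2.11 for the transcendental lattice = van Geemen 10.2–10.3, ON THE
REAL CARRIERS: FOR ALL Hodge-symmetric Hodge models `M` of `S`, all presentations `(T, H, P, j, ε)` of
the transcendental part with `h^{2,0} = 1` (`IsTranscendentalPartBetti`), all orthogonal `e₁, e₂ ∈ V`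
with `Q(eᵢ, eᵢ) < 0` and every `κ_C` which is van Geemen's inclusion `V ↪ C⁺(Q) ⊗ C⁺(Q)` for
`(E = Tr(e₁e₂ ι(·) ·), e₁)` (`KugaSatake.IsTensorEmbedding` — quantified exactly as in the tree's
framework-`B` predicate `BettiHodgeData.IsKSCorrespondenceAlgebraic`), and every Kuga–Satake variety
`(A, B, θ)` of `(T, H, P)` (`IsKugaSatakeVarietyBetti`), THERE IS a `ℂ`-linear map
`O : H²(S(ℂ); ℂ) → H²((A × A)(ℂ); ℂ)` INDUCED BY AN ALGEBRAIC CYCLE of codimension `2` on `(A × A) × S`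
(`IsAlgebraicCorrespondence (dim A + dim A) 2 (A × A) S O`: Huybrechts' class `κ_X ∈ H⁴`, Floccari's
"algebraic cycle on `S × KS(S)²`") whose restriction along `j` is the complexified Kuga–Satake class map:
`O (j t ⊗ 1) = μ'(t) ⊗ 1` for all `t ∈ T` (`ofRatClass` = the rational lattice `Hᵏ(–; ℚ) → Hᵏ(–; ℂ)`).
The choices quantified over are classically immaterial (Huybrechts Rem. 4.2.7, Varesco 2023 Rem. 4.3).
A predicate with the surface as argument, like the tree's `BettiHodgeData.IsKSCorrespondenceAlgebraic`.
[cite: Floccari2026, §3.3 (3.3) and Remark 3.4] [cite: Huybrechts2016K3, Ch. 4 §2.6 and 2.11]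
[cite: vanGeemen2000KugaSatakeHC, §10.2–10.3] -/
def IsKSCorrespondenceAlgebraicBetti {S : SchemeOver ℂ} (hS : IsSmoothProjective 2 S) : Prop :=
  ∀ (M : HodgeModel 2 S) (hM : M.IsHodgeSymmetric)
    (T : Type) [AddCommGroup T] [Module ℚ T] (H : HodgeStructure T 2) (P : H.Polarization)
    (hT : H.hodgeNumber 2 0 = 1) (ε : ℤˣ) (j : H.Hom (bettiTwoHodgeStructure hS M hM)),
    IsTranscendentalPartBetti hS M hM H P ε j →
  ∀ (e₁ e₂ : T), P.form e₁ e₂ = 0 → P.form e₁ e₁ < 0 → P.form e₂ e₂ < 0 →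
  ∀ (κC : T →ₗ[ℚ] CliffordAlgebra.even P.quadraticForm ⊗[ℚ] CliffordAlgebra.even P.quadraticForm),
    Motives.HodgeStructure.KugaSatake.IsTensorEmbedding P.quadraticForm
      (Motives.HodgeStructure.KugaSatake.traceForm P.quadraticForm
        ((CliffordAlgebra.even.ι P.quadraticForm).bilin e₁ e₂)) e₁ κC →
  ∀ (A : AbelianVariety ℂ) (B : HodgeModel A.dim A.X) (hB : B.IsHodgeSymmetric)
    (θ : bettiCohomology A.X 1 ≃ₗ[ℚ] CliffordAlgebra.even P.quadraticForm),
    IsKugaSatakeVarietyBetti H P hT A B hB θ →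
  ∃ O : complexBetti S (2 * 1) →ₗ[ℂ] complexBetti (A.X ⊗ A.X) 2,
    IsAlgebraicCorrespondence (A.dim + A.dim) 2 (A.X ⊗ A.X) S O ∧
      ∀ t : T, O (ofRatClass (Motives.ComplexPoints S) (2 * 1) (j.toLinearMap t)) =
        ofRatClass (Motives.ComplexPoints (A.X ⊗ A.X)) 2 (kugaSatakeClassMapBetti H P θ κC t)

end Correspondence

end Literature.AlgebraicGeometry.HodgeTheory

end
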